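import Literature.MathematicalPhysics.QuantumLattice.FrustratedHeisenbergSingletGroundStates
import HarnessLib

/-!
# The `J₁–J₂` square-lattice Heisenberg antiferromagnet: singlet ground states and the ice rule
# for `2|J₂| ≤ J₁` (Lieb–Schupp, via Wojtkiewicz's remark)

Topic `MathematicalPhysics/QuantumLattice`; the concrete instance of
`FrustratedHeisenbergSingletGroundStates.lean`. Sources:

* J. Wojtkiewicz, *Some properties of frustrated spin systems: extensions and applications of
  Lieb–Schupp approach*, Eur. Phys. J. B **44** (2005) 501 [Wojtkiewicz2005], §2, Remark: "`J₁–J₂`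
  2d Heisenberg model `H = J₁ Σ_{nn} 𝐬ᵢ·𝐬ⱼ + J₂ Σ_{nnn} 𝐬ᵢ·𝐬ⱼ` … Lieb and Schupp results apply for
  `J₂ ≤ ½J₁`. … [they] can be used to justify [the singlet] assumption … rigorous upper bounds for
  susceptibility";
* E. H. Lieb, P. Schupp, Phys. Rev. Lett. **83** (1999) 5362 [LiebSchupp1999], p. 4 ("In a system
  with periodic boundary conditions and an even number of sites in at least one direction we can
  choose the symmetry line(s) to intersect any given box, so … `⟨0|S³_tot|0⟩ = 0` … this implies
  that the total spin is zero for all ground states of such a system"); Physica A **279** (2000) 378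
  [LiebSchupp2000], §§5, 7.

## The instance

On the square torus `(ℤ/Lℤ)²` (`L` even, `L ≥ 4`) the coupling `J1J2.coupling J₁ J₂`: `J₁` on
nearest-neighbour pairs, `J₂` on diagonal (next-nearest-neighbour) pairs, `0` otherwise;
`J1J2.hamiltonian n J₁ J₂ = pairHeisenberg n (coupling J₁ J₂) = J₁ Σ_{⟨xy⟩} 𝐒_x·𝐒_y +
J₂ Σ_{⟨⟨xy⟩⟩} 𝐒_x·𝐒_y` (each unordered pair once). For the symmetry planes between the columns
`a` and `a + 1` (direction `0`), the crossing couplings between the boundary column `a + 1` (resp.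
`a + L/2`) and its mirror image form, row by row, the tridiagonal matrix `J₁ δ_{r r'} + J₂ δ_{|r-r'|=1}`,
which is the sum of squares `Σ_r (p δ_{·,r} + q δ_{·,r+1}) ⊗ (p δ_{·,r} + q δ_{·,r+1})` with
`p² + q² = J₁`, `pq = J₂` — solvable by reals exactly when `2|J₂| ≤ J₁` (`J1J2.ppar`, `J1J2.qpar`,
`p + q = √(J₁ + 2J₂)`). This is the Lieb–Schupp datum `J1J2.datum`; the crossing units are the
plaquette pairs `{(a+1, r), (a+1, r+1)} | {(a, r), (a, r+1)}`.

## Results (all spins `n/2`)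

* `J1J2.coupling_cross_eq_sum_datum` — the sum-of-squares identity (hypothesis `hC` of the
  general file) for every plane `a`; `J1J2.coupling_symm`, `J1J2.coupling_reflect`.
* `J1J2.exists_singlet_groundState` — **for `2|J₂| ≤ J₁` there is a ground state with total spin
  zero** (`S^α_tot ψ = 0`, all `α`) [Wojtkiewicz2005 §2; LiebSchupp2000 §5].
* `J1J2.iceRule` — **the ice rule**: for every ground-state vector `ψ`, every plane `a`, row `r`
  and component `α`, `⟨ψ, (p(S^α_{(a+1,r)} + S^α_{(a,r)}) + q(S^α_{(a+1,r+1)} + S^α_{(a,r+1)})) ψ⟩ = 0`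
  [LiebSchupp2000 §7].
* `J1J2.totalSpin_eq_sum_iceOp` — the covering identity `S^α_tot = (2(p+q))⁻¹ Σ_a Σ_r O_{a,r,α}`
  (`p + q ≠ 0`, i.e. `J₁ + 2J₂ > 0`).
* `J1J2.totalSpinSq_mulVec_eq_zero` — **for `2|J₂| ≤ J₁` and `J₁ + 2J₂ > 0`, EVERY ground state of
  the `J₁–J₂` model on the even torus is a singlet**: `(S_tot)² ψ = 0` [LiebSchupp1999 p. 4;
  Wojtkiewicz2005 §2].

## References
* [Wojtkiewicz2005] J. Wojtkiewicz, Eur. Phys. J. B 44 (2005) 501, §2 (Remark, `J₁–J₂` model).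
* [LiebSchupp1999] E. H. Lieb, P. Schupp, Phys. Rev. Lett. 83 (1999) 5362, p. 4.
* [LiebSchupp2000] E. H. Lieb, P. Schupp, Physica A 279 (2000) 378, §§5, 7.
-/

noncomputable section

open Matrix Finset
open scoped ComplexOrder
open Literature.MathematicalPhysics.QuantumLattice Literature.MathematicalPhysics.QuantumLattice.SpinOperators
  Literature.Probability.LatticeModels

namespace Literature.MathematicalPhysics.QuantumLattice

namespace J1J2

variable (L : ℕ) [NeZero L]

/-! ### §1. The coupling -/

/-- Kronecker delta `δ_{u,0}` on `ℤ/Lℤ`. [folklore] -/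
def delta0 (u : ZMod L) : ℝ := if u = 0 then 1 else 0

/-- The unit-step indicator `δ_{u,1} ∨ δ_{u,-1}` on `ℤ/Lℤ` (nearest neighbours along one axis).
[folklore] -/
def delta1 (u : ZMod L) : ℝ := if u = 1 ∨ u = -1 then 1 else 0

/-- **The `J₁–J₂` coupling** on the square torus `(ℤ/Lℤ)²`: `J₁` between nearest neighbours
(one coordinate equal, the other differing by `±1`), `J₂` between diagonal next-nearest neighbours
(both coordinates differing by `±1`), `0` otherwise ([Wojtkiewicz2005] §2:
`H = J₁ Σ_{n.n.} 𝐬ᵢ·𝐬ⱼ + J₂ Σ_{n.n.n.} 𝐬ᵢ·𝐬ⱼ`). [cite: Wojtkiewicz2005, §2] -/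
def coupling (J₁ J₂ : ℝ) (x y : TorusSite 2 L) : ℝ :=
  J₁ * (delta1 L (x 0 - y 0) * delta0 L (x 1 - y 1) + delta0 L (x 0 - y 0) * delta1 L (x 1 - y 1)) +
    J₂ * (delta1 L (x 0 - y 0) * delta1 L (x 1 - y 1))

/-- **The `J₁–J₂` Hamiltonian** `H = J₁ Σ_{⟨xy⟩} 𝐒_x·𝐒_y + J₂ Σ_{⟨⟨xy⟩⟩} 𝐒_x·𝐒_y` of spins `n/2` on
`(ℤ/Lℤ)²` (each unordered pair once: `pairHeisenberg` carries the `½`). [cite: Wojtkiewicz2005, §2] -/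
def hamiltonian (n : ℕ) (J₁ J₂ : ℝ) : Op (TorusSite 2 L) (n + 1) :=
  pairHeisenberg n (coupling L J₁ J₂)

variable {L}

omit [NeZero L] in
/-- `δ₀` is even. [folklore] -/
private theorem delta0_neg (u : ZMod L) : delta0 L (-u) = delta0 L u := by
  simp only [delta0, neg_eq_zero]

omit [NeZero L] in
/-- `δ₁` is even. [folklore] -/
private theorem delta1_neg (u : ZMod L) : delta1 L (-u) = delta1 L u := by
  have h : (-u = 1 ∨ -u = -1) ↔ (u = 1 ∨ u = -1) := by rw [neg_eq_iff_eq_neg, neg_inj, or_comm]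
  simp only [delta1, h]

omit [NeZero L] in
/-- The coupling is symmetric. [cite: Wojtkiewicz2005, §2] -/
theorem coupling_symm (J₁ J₂ : ℝ) (x y : TorusSite 2 L) :
    coupling L J₁ J₂ x y = coupling L J₁ J₂ y x := by
  have h0 : y 0 - x 0 = -(x 0 - y 0) := (neg_sub _ _).symm
  have h1 : y 1 - x 1 = -(x 1 - y 1) := (neg_sub _ _).symm
  rw [coupling, coupling, h0, h1, delta0_neg, delta1_neg, delta0_neg, delta1_neg]

omit [NeZero L] in
/-- The coupling is invariant under the reflection in the planes between the columns `a`, `a + 1`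
(and `a + L/2`, `a + L/2 + 1`). [cite: Wojtkiewicz2005, §2] -/
theorem coupling_reflect (a : ZMod L) (J₁ J₂ : ℝ) (x y : TorusSite 2 L) :
    coupling L J₁ J₂ (Torus.reflectBetweenSites 0 a x) (Torus.reflectBetweenSites 0 a y) =
      coupling L J₁ J₂ x y := by
  have h0 : Torus.reflectBetweenSites 0 a x 0 - Torus.reflectBetweenSites 0 a y 0 = -(x 0 - y 0) := by
    simp only [Torus.reflectBetweenSites_apply, Function.update_self]; ring
  have h1 : Torus.reflectBetweenSites 0 a x 1 - Torus.reflectBetweenSites 0 a y 1 = x 1 - y 1 := by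
    simp only [Torus.reflectBetweenSites_apply,
      Function.update_of_ne (show (1 : Fin 2) ≠ 0 by decide)]
  rw [coupling, coupling, h0, h1, delta0_neg, delta1_neg]

/-! ### §2. The Lieb–Schupp datum: `J₁ δ + J₂ δ_{±1} = Σ_r (pδ_r + qδ_{r+1})²` -/

variable (L)

/-- The two boundary columns of the left half `{a+1, …, a+L/2}`: `a + 1` (facing `a`) for
`b = false` and `a + L/2` (facing `a + L/2 + 1`) for `b = true`. [folklore] -/
def bcol (a : ZMod L) (b : Bool) : ZMod L := if b then a + (L / 2 : ℕ) else a + 1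

omit [NeZero L] in
/-- The lower boundary column. [folklore] -/
@[simp] private theorem bcol_false (a : ZMod L) : bcol L a false = a + 1 := rfl

omit [NeZero L] in
/-- The upper boundary column. [folklore] -/
@[simp] private theorem bcol_true (a : ZMod L) : bcol L a true = a + (L / 2 : ℕ) := rfl

/-- **The crossing datum** of the `J₁–J₂` model for the planes between the columns `a`, `a+1`:
the unit `(b, r)` is the pair of rows `{r, r+1}` of the boundary column `bcol a b`, with weights
`p` on row `r` and `q` on row `r + 1` (`p² + q² = J₁`, `pq = J₂`). [cite: Wojtkiewicz2005, §2] -/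
def datum (a : ZMod L) (p q : ℝ) (br : Bool × ZMod L) (s : TorusSite 2 L) : ℝ :=
  if s 0 = bcol L a br.1 then (if br.2 = s 1 then p else 0) + (if br.2 = s 1 - 1 then q else 0) else 0

variable {L}

/-- `Σ_r [r = u]x · [r = w]y = [u = w] xy`. [folklore] -/
private theorem sum_ite_mul_ite (u w : ZMod L) (x y : ℝ) :
    ∑ r : ZMod L, (if r = u then x else 0) * (if r = w then y else 0) =
      (if u = w then 1 else 0) * (x * y) := by
  rw [Finset.sum_eq_single_of_mem u (mem_univ u) (fun r _ hr => by rw [if_neg hr, zero_mul]), if_pos rfl]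
  by_cases h : u = w
  · rw [if_pos h, if_pos h, one_mul]
  · rw [if_neg h, if_neg h, mul_zero, zero_mul]

omit [NeZero L] in
/-- Casts of small naturals into `ℤ/Lℤ`: `(m : ℤ/Lℤ) = 0 ↔ m = 0` for `m < L`. [folklore] -/
private theorem natCast_eq_zero_of_lt {m : ℕ} (hm : m < L) : ((m : ZMod L) = 0) ↔ m = 0 := by
  rw [ZMod.natCast_eq_zero_iff]
  exact ⟨fun h => Nat.eq_zero_of_dvd_of_lt h hm, fun h => h ▸ dvd_zero L⟩

omit [NeZero L] in
/-- Casts of small naturals into `ℤ/Lℤ` are injective. [folklore] -/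
private theorem natCast_eq_natCast_of_lt {m k : ℕ} (hm : m < L) (hk : k < L) :
    ((m : ZMod L) = (k : ZMod L)) ↔ m = k := by
  rw [ZMod.natCast_eq_natCast_iff', Nat.mod_eq_of_lt hm, Nat.mod_eq_of_lt hk]

/-- The coordinate of a left site relative to the bottom column: `s₀ = a + 1 + m`, `m < L/2`.
[folklore] -/
private theorem exists_eq_add_of_mem {a : ZMod L} {s : TorusSite 2 L} (hs : s ∈ torusLeftHalf L 0 a) :
    ∃ m : ℕ, m < L / 2 ∧ s 0 = a + 1 + (m : ZMod L) :=
  ⟨(s 0 - (a + 1)).val, (mem_torusLeftHalf L 0 a).1 hs, by rw [ZMod.natCast_zmod_val]; ring⟩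

/-- **Geometry of the crossing pairs, same column test**: for left sites `s`, `s'` the mirror
image `θs'` is never in the column of `s`. [folklore] -/
private theorem delta0_cross (hL : Even L) {a : ZMod L} {s s' : TorusSite 2 L}
    (hs : s ∈ torusLeftHalf L 0 a) (hs' : s' ∈ torusLeftHalf L 0 a) :
    delta0 L (s 0 - Torus.reflectBetweenSites 0 a s' 0) = 0 := by
  obtain ⟨m, hm, hsm⟩ := exists_eq_add_of_mem hs
  obtain ⟨m', hm', hsm'⟩ := exists_eq_add_of_mem hs'
  obtain ⟨k, hk⟩ := hL
  have hkey : s 0 - Torus.reflectBetweenSites 0 a s' 0 = ((1 + m + m' : ℕ) : ZMod L) := by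
    simp only [Torus.reflectBetweenSites_apply, Function.update_self, hsm, hsm']
    push_cast; ring
  rw [delta0, hkey, if_neg]
  rw [natCast_eq_zero_of_lt (by omega)]
  omega

/-- **Geometry of the crossing pairs, adjacent column test**: for left sites `s`, `s'`, the column
of `θs'` is adjacent to the column of `s` iff `s`, `s'` lie in the same boundary column
(`a + 1` or `a + L/2`; `L ≥ 4` even). [folklore] -/
private theorem delta1_cross (hL : Even L) (hL4 : 4 ≤ L) {a : ZMod L} {s s' : TorusSite 2 L}
    (hs : s ∈ torusLeftHalf L 0 a) (hs' : s' ∈ torusLeftHalf L 0 a) :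
    delta1 L (s 0 - Torus.reflectBetweenSites 0 a s' 0) =
      (if s 0 = bcol L a false ∧ s' 0 = bcol L a false then 1 else 0) +
        (if s 0 = bcol L a true ∧ s' 0 = bcol L a true then 1 else 0) := by
  obtain ⟨m, hm, hsm⟩ := exists_eq_add_of_mem hs
  obtain ⟨m', hm', hsm'⟩ := exists_eq_add_of_mem hs'
  obtain ⟨k, hk⟩ := hL
  have hL0 : 0 < L := by omega
  have hkey : s 0 - Torus.reflectBetweenSites 0 a s' 0 = ((1 + m + m' : ℕ) : ZMod L) := by
    simp only [Torus.reflectBetweenSites_apply, Function.update_self, hsm, hsm']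
    push_cast; ring
  -- the two boundary conditions in terms of `m`, `m'`
  have hbot : ∀ {t : TorusSite 2 L} {i : ℕ}, i < L / 2 → t 0 = a + 1 + (i : ZMod L) →
      (t 0 = bcol L a false ↔ i = 0) := by
    intro t i hi ht
    rw [bcol_false, ht, add_eq_left, natCast_eq_zero_of_lt (by omega)]
  have htop : ∀ {t : TorusSite 2 L} {i : ℕ}, i < L / 2 → t 0 = a + 1 + (i : ZMod L) →
      (t 0 = bcol L a true ↔ i = L / 2 - 1) := by
    intro t i hi ht
    rw [bcol_true, ht, add_assoc, add_right_inj,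
      show (1 : ZMod L) + (i : ZMod L) = ((1 + i : ℕ) : ZMod L) by push_cast; ring,
      natCast_eq_natCast_of_lt (by omega) (by omega)]
    omega
  have h1 : ((1 + m + m' : ℕ) : ZMod L) = 1 ↔ m = 0 ∧ m' = 0 := by
    rw [show (1 : ZMod L) = ((1 : ℕ) : ZMod L) from Nat.cast_one.symm,
      natCast_eq_natCast_of_lt (by omega) (by omega)]
    omega
  have h2 : ((1 + m + m' : ℕ) : ZMod L) = -1 ↔ m = L / 2 - 1 ∧ m' = L / 2 - 1 := by
    rw [eq_neg_iff_add_eq_zero, show ((1 + m + m' : ℕ) : ZMod L) + 1 = ((2 + m + m' : ℕ) : ZMod L) by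
      push_cast; ring, ZMod.natCast_eq_zero_iff]
    constructor
    · rintro ⟨c, hc⟩
      rcases Nat.lt_or_ge c 2 with hc2 | hc2
      · interval_cases c <;> omega
      · have h' : L * 2 ≤ L * c := Nat.mul_le_mul_left L hc2
        omega
    · rintro ⟨rfl, rfl⟩
      exact ⟨1, by omega⟩
  have hcond : (((1 + m + m' : ℕ) : ZMod L) = 1 ∨ ((1 + m + m' : ℕ) : ZMod L) = -1) ↔
      ((m = 0 ∧ m' = 0) ∨ (m = L / 2 - 1 ∧ m' = L / 2 - 1)) := by rw [h1, h2]
  have hcb : (s 0 = bcol L a false ∧ s' 0 = bcol L a false) ↔ (m = 0 ∧ m' = 0) := by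
    rw [hbot hm hsm, hbot hm' hsm']
  have hct : (s 0 = bcol L a true ∧ s' 0 = bcol L a true) ↔ (m = L / 2 - 1 ∧ m' = L / 2 - 1) := by
    rw [htop hm hsm, htop hm' hsm']
  rw [delta1, hkey]
  simp only [hcond, hcb, hct]
  by_cases hb : m = 0 ∧ m' = 0
  · have ht : ¬ (m = L / 2 - 1 ∧ m' = L / 2 - 1) := by omega
    rw [if_pos (Or.inl hb), if_pos hb, if_neg ht, add_zero]
  · by_cases ht : m = L / 2 - 1 ∧ m' = L / 2 - 1
    · rw [if_pos (Or.inr ht), if_neg hb, if_pos ht, zero_add]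
    · rw [if_neg (not_or.2 ⟨hb, ht⟩), if_neg hb, if_neg ht, add_zero]

omit [NeZero L] in
/-- The row structure: `δ₁(u) = [u = 1] + [u = -1]` for `L ≥ 3` (`1 ≠ -1`). [folklore] -/
private theorem delta1_eq_add (hL4 : 4 ≤ L) (u : ZMod L) :
    delta1 L u = (if u = 1 then 1 else 0) + (if u = -1 then 1 else 0) := by
  have hne : (1 : ZMod L) ≠ -1 := by
    intro h
    rw [eq_neg_iff_add_eq_zero, show (1 : ZMod L) + 1 = ((2 : ℕ) : ZMod L) by push_cast; norm_num,
      ZMod.natCast_eq_zero_iff] at h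
    exact absurd (Nat.le_of_dvd (by norm_num) h) (by omega)
  rw [delta1]
  by_cases h1 : u = 1
  · rw [if_pos (Or.inl h1), if_pos h1, if_neg (h1 ▸ hne), add_zero]
  · by_cases h2 : u = -1
    · rw [if_pos (Or.inr h2), if_neg h1, if_pos h2, zero_add]
    · rw [if_neg (not_or.2 ⟨h1, h2⟩), if_neg h1, if_neg h2, add_zero]

/-- **The sum-of-squares identity** (hypothesis `hC` of the general theory; [Wojtkiewicz2005] §2
"Lieb and Schupp results apply for `J₂ ≤ ½J₁`"): for left sites `s`, `s'` of the planes between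
the columns `a`, `a + 1`, with `J₁ = p² + q²`, `J₂ = pq`,
`J(s, θs') = Σ_{(b,r)} v_{(b,r)}(s) v_{(b,r)}(s')`. [cite: Wojtkiewicz2005, §2] -/
theorem coupling_cross_eq_sum_datum (hL : Even L) (hL4 : 4 ≤ L) (a : ZMod L) (p q : ℝ)
    (s : TorusSite 2 L) (hs : s ∈ torusLeftHalf L 0 a) (s' : TorusSite 2 L)
    (hs' : s' ∈ torusLeftHalf L 0 a) :
    coupling L (p ^ 2 + q ^ 2) (p * q) s (Torus.reflectBetweenSites 0 a s') =
      ∑ br : Bool × ZMod L, datum L a p q br s * datum L a p q br s' := by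
  have hθ1 : Torus.reflectBetweenSites 0 a s' 1 = s' 1 := by
    simp only [Torus.reflectBetweenSites_apply, Function.update_of_ne (show (1 : Fin 2) ≠ 0 by decide)]
  -- the right-hand side, row sums first
  have e1 : (s 1 = s' 1 - 1) ↔ (s 1 - s' 1 = -1) := by
    constructor <;> intro h <;> linear_combination h
  have e2 : (s 1 - 1 = s' 1) ↔ (s 1 - s' 1 = 1) := by
    constructor <;> intro h <;> linear_combination h
  have e3 : (s 1 - 1 = s' 1 - 1) ↔ (s 1 = s' 1) := by
    constructor <;> intro h <;> linear_combination h
  have hrow : ∀ b : Bool, ∑ r : ZMod L, datum L a p q (b, r) s * datum L a p q (b, r) s' =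
      (if s 0 = bcol L a b ∧ s' 0 = bcol L a b then 1 else 0) *
        ((if s 1 = s' 1 then 1 else 0) * (p * p) + (if s 1 - s' 1 = -1 then 1 else 0) * (p * q) +
          ((if s 1 - s' 1 = 1 then 1 else 0) * (q * p) + (if s 1 = s' 1 then 1 else 0) * (q * q))) := by
    intro b
    by_cases hb : s 0 = bcol L a b ∧ s' 0 = bcol L a b
    · obtain ⟨hb1, hb2⟩ := hb
      rw [if_pos ⟨hb1, hb2⟩, one_mul]
      simp only [datum, hb1, hb2, if_true, add_mul, mul_add, Finset.sum_add_distrib, sum_ite_mul_ite,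
        e1, e2, e3]
      ring
    · rw [if_neg hb, zero_mul]
      refine Finset.sum_eq_zero fun r _ => ?_
      rcases not_and_or.1 hb with h | h
      · rw [datum, if_neg h, zero_mul]
      · rw [datum, datum, if_neg h, mul_zero]
  rw [Fintype.sum_prod_type, Fintype.sum_bool, hrow, hrow, coupling, hθ1, delta0_cross hL hs hs',
    delta1_cross hL hL4 hs hs', delta1_eq_add hL4 (s 1 - s' 1)]
  simp only [delta0, sub_eq_zero]
  ring

/-! ### §3. The parameters `p`, `q` -/

/-- `p = (√(J₁ + 2J₂) + √(J₁ - 2J₂))/2`. [cite: Wojtkiewicz2005, §2] -/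
def ppar (J₁ J₂ : ℝ) : ℝ := (Real.sqrt (J₁ + 2 * J₂) + Real.sqrt (J₁ - 2 * J₂)) / 2

/-- `q = (√(J₁ + 2J₂) - √(J₁ - 2J₂))/2`. [cite: Wojtkiewicz2005, §2] -/
def qpar (J₁ J₂ : ℝ) : ℝ := (Real.sqrt (J₁ + 2 * J₂) - Real.sqrt (J₁ - 2 * J₂)) / 2

/-- `p² + q² = J₁` for `2|J₂| ≤ J₁`. [cite: Wojtkiewicz2005, §2] -/
theorem ppar_sq_add_qpar_sq {J₁ J₂ : ℝ} (hJ : 2 * |J₂| ≤ J₁) :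
    ppar J₁ J₂ ^ 2 + qpar J₁ J₂ ^ 2 = J₁ := by
  have ha : 0 ≤ J₁ + 2 * J₂ := by cases abs_cases J₂ <;> linarith
  have hb : 0 ≤ J₁ - 2 * J₂ := by cases abs_cases J₂ <;> linarith
  have h1 := Real.sq_sqrt ha
  have h2 := Real.sq_sqrt hb
  simp only [ppar, qpar]
  nlinarith

/-- `pq = J₂` for `2|J₂| ≤ J₁`. [cite: Wojtkiewicz2005, §2] -/
theorem ppar_mul_qpar {J₁ J₂ : ℝ} (hJ : 2 * |J₂| ≤ J₁) : ppar J₁ J₂ * qpar J₁ J₂ = J₂ := by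
  have ha : 0 ≤ J₁ + 2 * J₂ := by cases abs_cases J₂ <;> linarith
  have hb : 0 ≤ J₁ - 2 * J₂ := by cases abs_cases J₂ <;> linarith
  have h1 := Real.sq_sqrt ha
  have h2 := Real.sq_sqrt hb
  simp only [ppar, qpar]
  nlinarith

/-- `p + q = √(J₁ + 2J₂)`, positive for `J₁ + 2J₂ > 0`. [cite: Wojtkiewicz2005, §2] -/
theorem ppar_add_qpar (J₁ J₂ : ℝ) : ppar J₁ J₂ + qpar J₁ J₂ = Real.sqrt (J₁ + 2 * J₂) := by
  simp only [ppar, qpar]; ring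

omit [NeZero L] in
/-- The coupling with `J₁ = p² + q²`, `J₂ = pq`. [cite: Wojtkiewicz2005, §2] -/
theorem coupling_eq_of_par {J₁ J₂ : ℝ} (hJ : 2 * |J₂| ≤ J₁) :
    coupling L J₁ J₂ = coupling L (ppar J₁ J₂ ^ 2 + qpar J₁ J₂ ^ 2) (ppar J₁ J₂ * qpar J₁ J₂) := by
  rw [ppar_sq_add_qpar_sq hJ, ppar_mul_qpar hJ]

/-! ### §4. The Lieb–Schupp theorems for the `J₁–J₂` model -/

/-- **A singlet ground state exists** for the `J₁–J₂` antiferromagnet on the even square torus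
(`L ≥ 4`) whenever `2|J₂| ≤ J₁` ([Wojtkiewicz2005] §2: "Lieb and Schupp results apply for
`J₂ ≤ ½J₁`"; [LiebSchupp2000] §5): some non-zero ground-state vector `ψ` has `S^α_tot ψ = 0` for
all three components. [cite: Wojtkiewicz2005, §2] [cite: LiebSchupp2000, §5] -/
theorem exists_singlet_groundState (n : ℕ) (hL : Even L) (hL4 : 4 ≤ L) {J₁ J₂ : ℝ}
    (hJ : 2 * |J₂| ≤ J₁) :
    ∃ ψ ∈ (hamiltonian L n J₁ J₂).groundSpace, ψ ≠ 0 ∧ ∀ α : Fin 3, totalSpin n α *ᵥ ψ = 0 := by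
  rw [hamiltonian, coupling_eq_of_par hJ]
  exact pairHeisenberg_exists_singlet_groundState (j := 0) (a := 0) hL (coupling_symm _ _)
    (coupling_reflect 0 _ _) (datum L 0 (ppar J₁ J₂) (qpar J₁ J₂))
    (coupling_cross_eq_sum_datum hL hL4 0 _ _)

/-- The ice operator of the unit `(b, r)` unfolded: `O = Σ_{s ∈ Λ_L} v(s)(S^α_s + S^α_{θs})`.
[cite: LiebSchupp2000, §7] -/
theorem lsIceOp_datum_eq (n : ℕ) (a : ZMod L) (p q : ℝ) (br : Bool × ZMod L) (α : Fin 3) :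
    lsIceOp L 0 a n (datum L a p q) br α =
      ∑ s ∈ torusLeftHalf L 0 a, (datum L a p q br s : ℂ) •
        (siteSpin n s α + siteSpin n (Torus.reflectBetweenSites 0 a s) α) := rfl

/-- **The ice rule for the `J₁–J₂` model** ([LiebSchupp2000] §7 eq. (ice), all three components;
[LiebSchupp1999] p. 4): for every ground-state vector `ψ` (`2|J₂| ≤ J₁`, `L ≥ 4` even), every plane
`a`, unit `(b, r)` and component `α`, the expectation of the ice operator
`Σ_s v_{(b,r)}(s)(S^α_s + S^α_{θs})` (`= p(S^α_{(c,r)} + S^α_{(c',r)}) + q(S^α_{(c,r+1)} + S^α_{(c',r+1)})`,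
`c = bcol a b`, `c'` its mirror column) vanishes. [cite: LiebSchupp2000, §7] [cite: LiebSchupp1999, p. 4] -/
theorem iceRule (n : ℕ) (hL : Even L) (hL4 : 4 ≤ L) {J₁ J₂ : ℝ} (hJ : 2 * |J₂| ≤ J₁) (a : ZMod L)
    (br : Bool × ZMod L) (α : Fin 3) {ψ : TensorIndex (TorusSite 2 L) (n + 1) → ℂ}
    (hψ : ψ ∈ (hamiltonian L n J₁ J₂).groundSpace) :
    star ψ ⬝ᵥ (lsIceOp L 0 a n (datum L a (ppar J₁ J₂) (qpar J₁ J₂)) br α *ᵥ ψ) = 0 := by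
  rw [hamiltonian, coupling_eq_of_par hJ] at hψ
  exact pairHeisenberg_iceRule hL (coupling_symm _ _) (coupling_reflect a _ _)
    (datum L a (ppar J₁ J₂) (qpar J₁ J₂)) (coupling_cross_eq_sum_datum hL hL4 a _ _) br α hψ

/-! #### The covering identity `S^α_tot = (2(p+q))⁻¹ Σ_a Σ_r O_{a,(false,r),α}` -/

/-- Row sums of the datum on the lower boundary column: `Σ_r v_{(false,r)}(s) = [s₀ = a+1](p+q)`.
[folklore] -/
private theorem sum_datum_false (a : ZMod L) (p q : ℝ) (s : TorusSite 2 L) :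
    ∑ r : ZMod L, datum L a p q (false, r) s = if s 0 = a + 1 then p + q else 0 := by
  by_cases h : s 0 = a + 1
  · simp only [datum, bcol_false, h, if_true, Finset.sum_add_distrib, Finset.sum_ite_eq', Finset.mem_univ]
  · rw [if_neg h]
    refine Finset.sum_eq_zero fun r _ => ?_
    simp only [datum, bcol_false]
    rw [if_neg h]

/-- The sites of the column `a + 1` all lie in the left half of the planes between `a`, `a + 1`.
[folklore] -/
private theorem mem_torusLeftHalf_of_eq (hL : Even L) {a : ZMod L} {s : TorusSite 2 L}
    (h : s 0 = a + 1) : s ∈ torusLeftHalf L 0 a := by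
  rw [mem_torusLeftHalf, h, sub_self, ZMod.val_zero]
  have : 0 < L := Nat.pos_of_ne_zero (NeZero.ne L)
  obtain ⟨k, hk⟩ := hL
  omega

/-- The ice operators of the lower boundary column of the plane `a` add up to
`(p+q)(Σ_{s₀ = a+1} S^α_s + Σ_{s₀ = a} S^α_s)`. [folklore] -/
private theorem sum_lsIceOp_false (n : ℕ) (hL : Even L) (a : ZMod L) (p q : ℝ) (α : Fin 3) :
    ∑ r : ZMod L, lsIceOp L 0 a n (datum L a p q) (false, r) α =
      ((p + q : ℝ) : ℂ) • (∑ s ∈ univ.filter (fun s : TorusSite 2 L => s 0 - 1 = a), siteSpin n s α +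
        ∑ s ∈ univ.filter (fun s : TorusSite 2 L => s 0 = a), siteSpin n s α) := by
  simp only [lsIceOp_datum_eq]
  rw [Finset.sum_comm]
  simp only [← Finset.sum_smul, ← Complex.ofReal_sum, sum_datum_false]
  -- restrict to the column `a + 1`
  have h1 : ∀ s : TorusSite 2 L, ((if s 0 = a + 1 then p + q else 0 : ℝ) : ℂ) •
      (siteSpin n s α + siteSpin n (Torus.reflectBetweenSites 0 a s) α) =
      if s 0 = a + 1 then ((p + q : ℝ) : ℂ) • (siteSpin n s α + siteSpin n (Torus.reflectBetweenSites 0 a s) α)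
        else 0 := by
    intro s
    split_ifs
    · rfl
    · rw [Complex.ofReal_zero, zero_smul]
  simp_rw [h1]
  rw [← Finset.sum_filter]
  have hfilt : (torusLeftHalf L 0 a).filter (fun s : TorusSite 2 L => s 0 = a + 1) =
      univ.filter (fun s : TorusSite 2 L => s 0 - 1 = a) := by
    ext s
    simp only [mem_filter, mem_univ, true_and, sub_eq_iff_eq_add]
    exact ⟨fun h => h.2, fun h => ⟨mem_torusLeftHalf_of_eq hL h, h⟩⟩
  have h2 : ∑ s ∈ univ.filter (fun s : TorusSite 2 L => s 0 - 1 = a),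
      ((p + q : ℝ) : ℂ) • siteSpin n (Torus.reflectBetweenSites 0 a s) α =
      ∑ s ∈ univ.filter (fun s : TorusSite 2 L => s 0 = a), ((p + q : ℝ) : ℂ) • siteSpin n s α := by
    refine Finset.sum_equiv (Torus.reflectBetweenSites 0 a) (fun s => ?_) (fun s _ => rfl)
    simp only [mem_filter, mem_univ, true_and, Torus.reflectBetweenSites_apply, Function.update_self]
    constructor <;> intro h <;> linear_combination (-1 : ZMod L) * h
  rw [hfilt, smul_add, Finset.smul_sum, Finset.smul_sum, ← h2, ← Finset.sum_add_distrib]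
  exact sum_congr rfl fun s _ => smul_add _ _ _

/-- **The covering identity**: summed over all planes `a ∈ ℤ/Lℤ` and all lower-column units, the
ice operators reproduce the total spin, `Σ_a Σ_r O_{a,(false,r),α} = 2(p+q) S^α_tot` — "we can
choose the symmetry line(s) to intersect any given box" ([LiebSchupp1999] p. 4).
[cite: LiebSchupp1999, p. 4] -/
theorem sum_lsIceOp_eq_smul_totalSpin (n : ℕ) (hL : Even L) (p q : ℝ) (α : Fin 3) :
    ∑ a : ZMod L, ∑ r : ZMod L, lsIceOp L 0 a n (datum L a p q) (false, r) α =
      ((2 * (p + q) : ℝ) : ℂ) • totalSpin n α := by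
  simp only [sum_lsIceOp_false n hL, smul_add, Finset.sum_add_distrib, ← Finset.smul_sum]
  rw [Finset.sum_fiberwise univ (fun s : TorusSite 2 L => s 0 - 1) (fun s => siteSpin n s α),
    Finset.sum_fiberwise univ (fun s : TorusSite 2 L => s 0) (fun s => siteSpin n s α), ← totalSpin,
    ← add_smul, ← Complex.ofReal_add, ← two_mul]

/-- The covering identity in the normalised form used by the general theory:
`S^α_tot = Σ_a Σ_{(b,r)} c_{(b,r)} O_{a,(b,r),α}` with `c_{(false,r)} = (2(p+q))⁻¹`, `c_{(true,r)} = 0`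
(`p + q ≠ 0`). [cite: LiebSchupp1999, p. 4] -/
theorem totalSpin_eq_sum_iceOp (n : ℕ) (hL : Even L) {p q : ℝ} (hpq : p + q ≠ 0) (α : Fin 3) :
    (totalSpin n α : Op (TorusSite 2 L) (n + 1)) =
      ∑ a : ZMod L, ∑ br : Bool × ZMod L,
        (if br.1 then (0 : ℂ) else (((2 * (p + q))⁻¹ : ℝ) : ℂ)) • lsIceOp L 0 a n (datum L a p q) br α := by
  simp only [Fintype.sum_prod_type, Fintype.sum_bool, if_true, zero_smul, Finset.sum_const_zero, zero_add,
    Bool.false_eq_true, if_false, ← Finset.smul_sum]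
  rw [sum_lsIceOp_eq_smul_totalSpin n hL p q α, smul_smul, ← Complex.ofReal_mul,
    inv_mul_cancel₀ (mul_ne_zero two_ne_zero hpq), Complex.ofReal_one, one_smul]

/-- **All ground states of the `J₁–J₂` model are singlets** ([LiebSchupp1999] p. 4: "in such a
system the magnetization is zero both for every single box separately and also for the whole
system … this implies that the total spin is zero for all ground states"; [Wojtkiewicz2005] §2:
"if the system has periodic boundary condition in at least one direction, then all ground states
are singlets"): on the even square torus with `L ≥ 4`, for `2|J₂| ≤ J₁` and `J₁ + 2J₂ > 0`, every
ground-state vector `ψ` of `H_{J₁,J₂}` satisfies `S^α_tot ψ = 0` (`α = 1, 2, 3`) and hence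
`(S_tot)² ψ = 0`. [cite: LiebSchupp1999, p. 4] [cite: Wojtkiewicz2005, §2] -/
theorem totalSpin_mulVec_eq_zero (n : ℕ) (hL : Even L) (hL4 : 4 ≤ L) {J₁ J₂ : ℝ}
    (hJ : 2 * |J₂| ≤ J₁) (hJ' : 0 < J₁ + 2 * J₂) (α : Fin 3)
    {ψ : TensorIndex (TorusSite 2 L) (n + 1) → ℂ} (hψ : ψ ∈ (hamiltonian L n J₁ J₂).groundSpace) :
    totalSpin n α *ᵥ ψ = 0 := by
  have hpq : ppar J₁ J₂ + qpar J₁ J₂ ≠ 0 := by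
    rw [ppar_add_qpar]; exact (Real.sqrt_pos.2 hJ').ne'
  rw [hamiltonian, coupling_eq_of_par hJ] at hψ
  exact pairHeisenberg_totalSpin_mulVec_eq_zero_of_cover (κ := Bool × ZMod L) (P := ZMod L) hL
    (coupling_symm _ _) (fun _ => (0 : Fin 2)) (fun a => a)
    (fun a => datum L a (ppar J₁ J₂) (qpar J₁ J₂)) (fun a => coupling_reflect a _ _)
    (fun a => coupling_cross_eq_sum_datum hL hL4 a _ _) α
    (fun _ br => if br.1 then (0 : ℂ) else (((2 * (ppar J₁ J₂ + qpar J₁ J₂))⁻¹ : ℝ) : ℂ))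
    (totalSpin_eq_sum_iceOp n hL hpq α) hψ

/-- **Corollary**: `(S_tot)² ψ = 0` for every ground-state vector — all ground states of the
`J₁–J₂` model (`2|J₂| ≤ J₁`, `J₁ + 2J₂ > 0`, even torus, `L ≥ 4`) have total spin zero.
[cite: LiebSchupp1999, p. 4] [cite: Wojtkiewicz2005, §2] -/
theorem totalSpinSq_mulVec_eq_zero (n : ℕ) (hL : Even L) (hL4 : 4 ≤ L) {J₁ J₂ : ℝ}
    (hJ : 2 * |J₂| ≤ J₁) (hJ' : 0 < J₁ + 2 * J₂)
    {ψ : TensorIndex (TorusSite 2 L) (n + 1) → ℂ} (hψ : ψ ∈ (hamiltonian L n J₁ J₂).groundSpace) :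
    totalSpinSq n *ᵥ ψ = 0 := by
  rw [totalSpinSq, sum_mulVec]
  refine sum_eq_zero fun α _ => ?_
  rw [← mulVec_mulVec, totalSpin_mulVec_eq_zero n hL hL4 hJ hJ' α hψ, mulVec_zero]

end J1J2

end Literature.MathematicalPhysics.QuantumLattice
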